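import Summits.Ventures.Crystal3D.Theorems.StickyWulffConstantCoaxialWallLawQuietSetComparison
import HarnessLib

/-!
# THE EXACT / SEAM SPLIT of the joint (A)-summand at a residual payer (crux `CoaxialWallLaw`, stmt-Ventures-19481; line `WallLedgerF`,
# skeleton 'CoaxialWallLawCertificates' v5, stub `stub_seamResidual`; the consumer shape of 19481-p2 g11's 13:39Z bus line)

HONEST FRAMING. Venture `Summits/Ventures/Crystal3D` (cell `crystal3d-full`); DEFINITIONS + a census-free split inequality for the crux `CoaxialWallLaw`
(stmt-Ventures-19481, `route-Ventures-StickyWulffConstant`), registered line 'Certificates' v5.  Nothing about the stub is claimed; F-C1 not moved.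
By `…MonoOfNonCapping` a residual window contains, for every placement, a non-exact ball that takes part in a firing (A)-pair near the payer.  This file
separates the (A)-pairs at a payer (model position, payer `0`) into EXACT pairs — reader, end ball and every inspected ball at exact positions (`exactPos`:
module sites ∪ first-generation apex positions) — and SEAM pairs (the rest), and bounds the two parts separately:
* `IsExactPairA`, `exactMultA`, `seamMultA`, `exactMultA_add_seamMultA` (`= endMultA`);
* **`isEndPairA_exactOf_of_exact`** — an exact pair of `Y` is an (A)-end pair of the EXACT PART `exactOf Y` (`isEndMove_of_exact`), so
  `exactMultA Y b ≤ endMultA (exactOf Y) b` (`exactMultA_le`);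
* pools: `pooledDef (exactOf Y) b + def(b) ≤ pooledDef Y b + heal(b)` is `pooledDef_sdiff_le` of `…QuietSetComparison` with `J = Y \ exactOf Y`
  (`pooledDef_exactOf_le`);
* **`localSummandA_le_exact_add_seam`** — `Σ_A(Y, 0) ≤ Σ_{b exact} e_E(b) / (p_E(b) − heal(b) + def(b)) + #{seam end balls within 1} / p₀` whenever the
  lowered exact pools are positive and every SEAM end ball `b` within `1` of the payer has `p₀ · seamMultA b ≤ pooledDef Y b`.  The first term is a functional of
  the EXACT SKELETON with lowered pools (a lens type with healing data — the census extension «LensCert with lowPool»), the second is the END-POOL ratio over seam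
  end balls only (the motif numerics).
WHAT THIS IS NOT: neither input is claimed; F-C1 not moved.
-/

noncomputable section

namespace Summit.Ventures.Crystal3D.Theorems

namespace TailResidue

open Summit.Ventures.Crystal3D Finset
open scoped InnerProductSpace

section Split

variable (Y : Finset (EuclideanSpace ℝ (Fin 3))) (v : WordVersion) (S₁ S₂ : PlateSystem)

/-- **EXACT (A)-END PAIR**: an (A)-end pair `(b, q)` witnessed by a class whose reader, end ball and every inspected ball of the window are at exact positions. -/
def IsExactPairA (b q : EuclideanSpace ℝ (Fin 3)) : Prop :=
  q ∈ Y ∧ b ∈ Y ∧ HasTwoPayers Y b ∧ ∃ G : EuclideanSpace ℝ (Fin 3) ≃ₗᵢ[ℝ] EuclideanSpace ℝ (Fin 3), ∃ d : EuclideanSpace ℝ (Fin 3),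
    (S₁.Adm G d ∨ S₂.Adm G d) ∧ q - d ∈ Y ∧ IsEndMove Y v G d q b ∧ q ∈ exactPos ∧ b ∈ exactPos ∧ ∀ x ∈ Y, InspectedAt G q b x → x ∈ exactPos

open scoped Classical in
/-- Multiplicity of `b` through EXACT pairs. -/
def exactMultA (b : EuclideanSpace ℝ (Fin 3)) : ℕ := (Y.filter fun q => IsExactPairA Y v S₁ S₂ b q).card

open scoped Classical in
/-- Multiplicity of `b` through SEAM pairs: (A)-end pairs that are not exact. -/
def seamMultA (b : EuclideanSpace ℝ (Fin 3)) : ℕ := (Y.filter fun q => IsEndPairA Y v S₁ S₂ b q ∧ ¬ IsExactPairA Y v S₁ S₂ b q).card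

variable {Y v S₁ S₂}

/-- An exact pair is an (A)-end pair. -/
theorem isEndPairA_of_exact {b q : EuclideanSpace ℝ (Fin 3)} (h : IsExactPairA Y v S₁ S₂ b q) : IsEndPairA Y v S₁ S₂ b q := by
  obtain ⟨hq, hb, hpay, G, d, hadm, hqd, hmove, -, -, -⟩ := h
  exact ⟨hq, hb, hpay, G, d, hadm, hqd, hmove⟩

open scoped Classical in
/-- `endMultA = exactMultA + seamMultA`. -/
theorem exactMultA_add_seamMultA (b : EuclideanSpace ℝ (Fin 3)) : exactMultA Y v S₁ S₂ b + seamMultA Y v S₁ S₂ b = endMultA Y v S₁ S₂ b := by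
  unfold exactMultA seamMultA endMultA
  rw [← card_union_of_disjoint]
  · congr 1
    ext q
    simp only [mem_union, mem_filter]
    constructor
    · rintro (⟨hq, he⟩ | ⟨hq, hp, -⟩)
      · exact ⟨hq, isEndPairA_of_exact he⟩
      · exact ⟨hq, hp⟩
    · rintro ⟨hq, hp⟩
      by_cases he : IsExactPairA Y v S₁ S₂ b q
      · exact Or.inl ⟨hq, he⟩
      · exact Or.inr ⟨hq, hp, he⟩
  · exact disjoint_left.2 fun q h1 h2 => (mem_filter.1 h2).2.2 (mem_filter.1 h1).2

/-! ### Exact pairs live on the exact part -/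

variable (hY : ∀ p ∈ Y, ∀ q ∈ Y, p ≠ q → 1 ≤ dist p q) (h₁ : S₁.RT ⊆ fccSlots) (h₂ : S₂.RT ⊆ fccSlots)

set_option maxRecDepth 65536 in
-- the window Finsets (`siteBall`, `apexBall`) are large closed terms; unification around them needs a deeper recursion budget
include hY h₁ h₂ in
open scoped Classical in
/-- **An exact pair of `Y` is an (A)-end pair of the exact part `exactOf Y`.** -/
theorem isEndPairA_exactOf_of_exact {b q : EuclideanSpace ℝ (Fin 3)} (h : IsExactPairA Y v S₁ S₂ b q) : IsEndPairA (exactOf Y) v S₁ S₂ b q := by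
  obtain ⟨hq, hb, hpay, G, d, hadm, hqd, hmove, hqE, hbE, hins⟩ := h
  set E := exactOf Y with hEdef
  have keep : ∀ {y}, y ∈ Y → y ∈ exactPos → y ∈ E := fun hy hyE => by rw [hEdef]; exact mem_exactOf_iff.2 ⟨hy, hyE⟩
  have hsub : E ⊆ Y := by rw [hEdef]; exact exactOf_subset Y
  clear_value E
  have hbE' : b ∈ E := keep hb hbE
  refine ⟨keep hq hqE, hbE', ?_, G, d, hadm, ?_, isEndMove_of_exact hsub hmove hbE' fun x hx hix => keep hx (hins x hx hix)⟩
  · -- two-payer clause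
    have hdeg : ∀ y, (E.filter fun q => dist y q = 1).card ≤ (Y.filter fun q => dist y q = 1).card :=
      fun y => card_le_card (fun p hp => by rw [mem_filter] at hp ⊢; exact ⟨hsub hp.1, hp.2⟩)
    rcases hpay with hle | ⟨z₁, hz₁, z₂, hz₂, hne, hd₁, hd₂, hdeg₁, hdeg₂⟩
    · exact Or.inl ((hdeg b).trans hle)
    · have drop : ∀ {w}, w ∈ Y → w ∉ E → dist b w = 1 → (E.filter fun q => dist b q = 1).card ≤ 11 := by
        intro w hw hwE hd
        have hwmem : w ∈ Y.filter fun q => dist b q = 1 := mem_filter.2 ⟨hw, hd⟩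
        have hs : E.filter (fun q => dist b q = 1) ⊆ (Y.filter fun q => dist b q = 1).erase w := by
          intro p hp; rw [mem_filter] at hp
          exact mem_erase.2 ⟨fun h => hwE (h ▸ hp.1), mem_filter.2 ⟨hsub hp.1, hp.2⟩⟩
        have h12 := card_filter_dist_eq_one_le_twelve Y hY b
        have hc := card_le_card hs
        rw [card_erase_of_mem hwmem] at hc
        omega
      by_cases hE₁ : z₁ ∈ E
      · by_cases hE₂ : z₂ ∈ E
        · exact Or.inr ⟨z₁, hE₁, z₂, hE₂, hne, hd₁, hd₂, (hdeg z₁).trans hdeg₁, (hdeg z₂).trans hdeg₂⟩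
        · exact Or.inl (drop hz₂ hE₂ hd₂)
      · exact Or.inl (drop hz₁ hE₁ hd₁)
  · -- the predecessor is inspected, hence exact
    obtain ⟨w₀, hw₀, hdw⟩ : ∃ w₀ ∈ fccSlots, -d = G w₀ := by
      rcases hadm with h | h
      · exact (exists_slots_of_adm h₁ h).2
      · exact (exists_slots_of_adm h₂ h).2
    refine keep hqd (hins _ hqd ⟨w₀, hw₀, Or.inl ?_⟩)
    rw [sub_eq_add_neg, hdw]

set_option maxRecDepth 65536 in
-- the window Finsets (`siteBall`, `apexBall`) are large closed terms; unification around them needs a deeper recursion budget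
include hY h₁ h₂ in
open scoped Classical in
/-- **Exact multiplicities are bounded by the (A)-multiplicities of the exact part.** -/
theorem exactMultA_le (b : EuclideanSpace ℝ (Fin 3)) : exactMultA Y v S₁ S₂ b ≤ endMultA (exactOf Y) v S₁ S₂ b := by
  unfold exactMultA endMultA
  refine card_le_card fun q hq => ?_
  rw [mem_filter] at hq ⊢
  have hp := isEndPairA_exactOf_of_exact hY h₁ h₂ hq.2
  exact ⟨hp.1, hp⟩

set_option maxRecDepth 65536 in
-- the window Finsets (`siteBall`, `apexBall`) are large closed terms; unification around them needs a deeper recursion budget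
include hY in
open scoped Classical in
/-- **Pools of the exact part**: `pooledDef (exactOf Y) b + def(b) ≤ pooledDef Y b + heal(b)` (foreign = non-exact balls of `Y`). -/
theorem pooledDef_exactOf_le (b : EuclideanSpace ℝ (Fin 3)) :
    pooledDef (exactOf Y) b +
        ∑ x ∈ (Y \ exactOf Y).filter (fun x => dist b x ≤ 1 ∧ (Y.filter fun q => dist x q = 1).card ≤ 11),
          ((12 : ℝ) - ((Y.filter fun q => dist x q = 1).card : ℝ)) ≤
      pooledDef Y b + ((((exactOf Y).filter fun y => dist b y ≤ 1) ×ˢ (Y \ exactOf Y)).filter fun p => dist p.1 p.2 = 1).card := by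
  have hE : Y \ (Y \ exactOf Y) = exactOf Y := Finset.sdiff_sdiff_eq_self (exactOf_subset Y)
  have h := pooledDef_sdiff_le (X := Y) (J := Y \ exactOf Y) hY sdiff_subset b
  rw [hE] at h
  exact h

/-! ### The split inequality -/

set_option maxRecDepth 65536 in
-- the window Finsets (`siteBall`, `apexBall`) are large closed terms; unification around them needs a deeper recursion budget
include hY h₁ h₂ in
open scoped Classical in
/-- **THE EXACT / SEAM SPLIT.**  With `E = exactOf Y`, `heal(b)` = #(exact within `1` of `b`, non-exact) contacts, `def(b)` = deficiency of the non-exact balls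
within `1` of `b`: if every lowered pool `p_E(b) − heal(b) + def(b)` at an exact ball within `1` of the payer is positive, and every SEAM end ball `b` within
`1` of the payer has `p₀ · seamMultA b ≤ pooledDef Y b` (`p₀ > 0`), then
`Σ_A(Y, 0) ≤ Σ_{b ∈ E, |b| ≤ 1} e_E(b) / (p_E(b) − heal(b) + def(b)) + #{b ∈ Y : |b| ≤ 1, seamMultA b > 0} / p₀`. -/
theorem localSummandA_le_exact_add_seam {p₀ : ℝ} (hp₀ : 0 < p₀)
    (hposE : ∀ b ∈ exactOf Y, dist (0 : EuclideanSpace ℝ (Fin 3)) b ≤ 1 →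
      0 < pooledDef (exactOf Y) b - (((((exactOf Y).filter fun y => dist b y ≤ 1) ×ˢ (Y \ exactOf Y)).filter fun p => dist p.1 p.2 = 1).card : ℝ) +
        ∑ x ∈ (Y \ exactOf Y).filter (fun x => dist b x ≤ 1 ∧ (Y.filter fun q => dist x q = 1).card ≤ 11),
          ((12 : ℝ) - ((Y.filter fun q => dist x q = 1).card : ℝ)))
    (hseam : ∀ b ∈ Y, dist (0 : EuclideanSpace ℝ (Fin 3)) b ≤ 1 → 0 < seamMultA Y v S₁ S₂ b → p₀ * (seamMultA Y v S₁ S₂ b : ℝ) ≤ pooledDef Y b) :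
    localSummandA v S₁ S₂ Y 0 ≤
      (∑ b ∈ (exactOf Y).filter (fun b => dist (0 : EuclideanSpace ℝ (Fin 3)) b ≤ 1 ∧ 0 < endMultA (exactOf Y) v S₁ S₂ b),
        (endMultA (exactOf Y) v S₁ S₂ b : ℝ) /
          (pooledDef (exactOf Y) b - (((((exactOf Y).filter fun y => dist b y ≤ 1) ×ˢ (Y \ exactOf Y)).filter fun p => dist p.1 p.2 = 1).card : ℝ) +
            ∑ x ∈ (Y \ exactOf Y).filter (fun x => dist b x ≤ 1 ∧ (Y.filter fun q => dist x q = 1).card ≤ 11),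
              ((12 : ℝ) - ((Y.filter fun q => dist x q = 1).card : ℝ)))) +
      ((Y.filter fun b => dist (0 : EuclideanSpace ℝ (Fin 3)) b ≤ 1 ∧ 0 < seamMultA Y v S₁ S₂ b).card : ℝ) / p₀ := by
  unfold localSummandA
  set E := exactOf Y with hEdef
  have hkeep : ∀ {y}, y ∈ Y → y ∈ exactPos → y ∈ E := fun hy hyE => by rw [hEdef]; exact mem_exactOf_iff.2 ⟨hy, hyE⟩
  have hexle : ∀ b, exactMultA Y v S₁ S₂ b ≤ endMultA E v S₁ S₂ b := fun b => by rw [hEdef]; exact exactMultA_le hY h₁ h₂ b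
  have hpoolle : ∀ b, pooledDef E b +
      ∑ x ∈ (Y \ E).filter (fun x => dist b x ≤ 1 ∧ (Y.filter fun q => dist x q = 1).card ≤ 11), ((12 : ℝ) - ((Y.filter fun q => dist x q = 1).card : ℝ)) ≤
      pooledDef Y b + (((E.filter fun y => dist b y ≤ 1) ×ˢ (Y \ E)).filter fun p => dist p.1 p.2 = 1).card := fun b => by
    rw [hEdef]; exact pooledDef_exactOf_le hY b
  clear_value E
  set A := Y.filter (fun b => dist (0 : EuclideanSpace ℝ (Fin 3)) b ≤ 1 ∧ 0 < endMultA Y v S₁ S₂ b) with hA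
  set AE := E.filter (fun b => dist (0 : EuclideanSpace ℝ (Fin 3)) b ≤ 1 ∧ 0 < endMultA E v S₁ S₂ b) with hAE
  set AS := Y.filter (fun b => dist (0 : EuclideanSpace ℝ (Fin 3)) b ≤ 1 ∧ 0 < seamMultA Y v S₁ S₂ b) with hAS
  set D : EuclideanSpace ℝ (Fin 3) → ℝ := fun b =>
    pooledDef E b - ((((E.filter fun y => dist b y ≤ 1) ×ˢ (Y \ E)).filter fun p => dist p.1 p.2 = 1).card : ℝ) +
      ∑ x ∈ (Y \ E).filter (fun x => dist b x ≤ 1 ∧ (Y.filter fun q => dist x q = 1).card ≤ 11), ((12 : ℝ) - ((Y.filter fun q => dist x q = 1).card : ℝ))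
    with hD
  set gE : EuclideanSpace ℝ (Fin 3) → ℝ := fun b => (endMultA E v S₁ S₂ b : ℝ) / D b with hgE
  set fX : EuclideanSpace ℝ (Fin 3) → ℝ := fun b => (exactMultA Y v S₁ S₂ b : ℝ) / pooledDef Y b with hfX
  set fS : EuclideanSpace ℝ (Fin 3) → ℝ := fun b => (seamMultA Y v S₁ S₂ b : ℝ) / pooledDef Y b with hfS
  -- pools of loaded balls are positive: the payer `0`… we only need positivity where used; get it from the two hypotheses
  -- termwise split of the summand
  have hsplit : ∀ b ∈ A, (endMultA Y v S₁ S₂ b : ℝ) / pooledDef Y b = fX b + fS b := by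
    intro b _
    simp only [hfX, hfS, ← add_div]
    congr 1
    exact_mod_cast (exactMultA_add_seamMultA (Y := Y) (v := v) (S₁ := S₁) (S₂ := S₂) b).symm
  rw [sum_congr rfl hsplit, sum_add_distrib]
  -- exact part
  have hexact : ∑ b ∈ A, fX b ≤ ∑ b ∈ AE, gE b := by
    have key : ∀ b ∈ A, (0 < exactMultA Y v S₁ S₂ b → b ∈ AE ∧ fX b ≤ gE b) ∧ (exactMultA Y v S₁ S₂ b = 0 → fX b = 0) := by
      intro b hb
      obtain ⟨hbY, hb1, hepos⟩ := mem_filter.1 hb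
      refine ⟨fun hx => ?_, fun h0 => by simp only [hfX, h0, Nat.cast_zero, zero_div]⟩
      -- `b` is exact (it is the end ball of an exact pair)
      obtain ⟨q, hq⟩ : ∃ q, q ∈ Y.filter fun q => IsExactPairA Y v S₁ S₂ b q := by
        by_contra hne
        push Not at hne
        have : exactMultA Y v S₁ S₂ b = 0 := by
          unfold exactMultA; rw [card_eq_zero]; exact eq_empty_of_forall_notMem hne
        omega
      obtain ⟨-, -, -, G, d, -, -, -, -, hbEx, -⟩ := (mem_filter.1 hq).2
      have hbE : b ∈ E := hkeep hbY hbEx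
      have hle := hexle b
      have hp := hpoolle b
      have hDpos : 0 < D b := hposE b hbE hb1
      have hDle : D b ≤ pooledDef Y b := by simp only [hD]; linarith
      refine ⟨mem_filter.2 ⟨hbE, hb1, lt_of_lt_of_le hx hle⟩, ?_⟩
      have hleR : (exactMultA Y v S₁ S₂ b : ℝ) ≤ (endMultA E v S₁ S₂ b : ℝ) := by exact_mod_cast hle
      calc fX b = (exactMultA Y v S₁ S₂ b : ℝ) / pooledDef Y b := rfl
        _ ≤ (endMultA E v S₁ S₂ b : ℝ) / pooledDef Y b := div_le_div_of_nonneg_right hleR (hDpos.le.trans hDle)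
        _ ≤ gE b := div_le_div_of_nonneg_left (Nat.cast_nonneg _) hDpos hDle
    have hgnn : ∀ b ∈ AE, 0 ≤ gE b := fun b hb => div_nonneg (Nat.cast_nonneg _) (hposE b (mem_filter.1 hb).1 (mem_filter.1 hb).2.1).le
    calc ∑ b ∈ A, fX b = ∑ b ∈ A.filter (fun b => 0 < exactMultA Y v S₁ S₂ b), fX b :=
          (sum_filter_of_ne fun b hb hne => Nat.pos_of_ne_zero fun h0 => hne ((key b hb).2 h0)).symm
      _ ≤ ∑ b ∈ A.filter (fun b => 0 < exactMultA Y v S₁ S₂ b), gE b :=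
          sum_le_sum fun b hb => ((key b (mem_filter.1 hb).1).1 (mem_filter.1 hb).2).2
      _ ≤ ∑ b ∈ AE, gE b :=
          sum_le_sum_of_subset_of_nonneg (fun b hb => ((key b (mem_filter.1 hb).1).1 (mem_filter.1 hb).2).1) fun b hb _ => hgnn b hb
  -- seam part
  have hseam' : ∑ b ∈ A, fS b ≤ (AS.card : ℝ) / p₀ := by
    have key : ∀ b ∈ A, (0 < seamMultA Y v S₁ S₂ b → b ∈ AS ∧ fS b ≤ 1 / p₀) ∧ (seamMultA Y v S₁ S₂ b = 0 → fS b = 0) := by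
      intro b hb
      obtain ⟨hbY, hb1, -⟩ := mem_filter.1 hb
      refine ⟨fun hs => ⟨mem_filter.2 ⟨hbY, hb1, hs⟩, ?_⟩, fun h0 => by simp only [hfS, h0, Nat.cast_zero, zero_div]⟩
      have hle := hseam b hbY hb1 hs
      have hspos : (0 : ℝ) < (seamMultA Y v S₁ S₂ b : ℝ) := by exact_mod_cast hs
      have hP : 0 < pooledDef Y b := lt_of_lt_of_le (mul_pos hp₀ hspos) hle
      simp only [hfS]
      rw [div_le_div_iff₀ hP hp₀, one_mul, mul_comm]
      exact hle
    calc ∑ b ∈ A, fS b = ∑ b ∈ A.filter (fun b => 0 < seamMultA Y v S₁ S₂ b), fS b :=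
          (sum_filter_of_ne fun b hb hne => Nat.pos_of_ne_zero fun h0 => hne ((key b hb).2 h0)).symm
      _ ≤ ∑ b ∈ A.filter (fun b => 0 < seamMultA Y v S₁ S₂ b), 1 / p₀ :=
          sum_le_sum fun b hb => ((key b (mem_filter.1 hb).1).1 (mem_filter.1 hb).2).2
      _ ≤ ∑ b ∈ AS, 1 / p₀ :=
          sum_le_sum_of_subset_of_nonneg (fun b hb => ((key b (mem_filter.1 hb).1).1 (mem_filter.1 hb).2).1) fun _ _ _ => by positivity
      _ = (AS.card : ℝ) / p₀ := by rw [sum_const, nsmul_eq_mul, mul_one_div]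
  linarith

end Split

end TailResidue

end Summit.Ventures.Crystal3D.Theorems

end
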